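import Literature.NumberTheory.LFunctions.BuiHall.Sign3
import Literature.NumberTheory.LFunctions.BuiHall.MasterTT
import Literature.NumberTheory.LFunctions.BuiHall.MasterTF
import Literature.NumberTheory.LFunctions.BuiHall.MasterF
import Literature.NumberTheory.LFunctions.RiemannSiegel
import HarnessLib

/-!
# Bui–Hall sign conjecture, hub-kernel port — FINAL ASSEMBLY: `Λ ≤ 0` on `D` from the three parts, the Bui–Hall main term (cited
# named fact), Theorem BH, and the sign conjecture `theorem_BH_sign` WITHOUT hypotheses

LINE 1 — LABEL: RH-FREE (a theorem about explicit polynomial integrals — the sign of the main-term coefficient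
`HARDY(k,ℓ,m,n)` of the mixed fourth moments of the derivatives of Hardy's `Z`); LADDER-RH materiality NIL
(director-rh 2026-08-27); class RECORDS → PAPERS. Nothing here bears on the truth of RH.

PROVENANCE (byte level). Hub-kernel PORT of the box file `run/shared/lean/archive/2001-boxes/rh/summits/rh-w-lgap/free/y2/lean/BuiHallSign.lean` (sha256/16 `560d5e447cc8ed51`),
itself GENERATED by `run/shared/lean/archive/2001-boxes/rh/summits/rh-w-lgap/free/y2/lean/gen/gen_bh.py` (sha256/16 `80cee6d9d1ddbd5e`; `--assemble` from cells.json sha256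
`03ab224ad42ef36c…` + certs.jsonl sha256 `240e612880cce7bc…`, run rh-lgapy2-bh-2, and the hand-written parts `gen/part_*.lean`).
This module = the box file's `master_ineq` (now fed by the part theorems instead of the three seam hypotheses) and its section `final` (Hardy's function now the TREE's `hardyZ`; `theorem_BH_sign` now hypothesis-free; `theorem_BH` keeps only the cited analytic input `BuiHallMainTerm`).  Port edits ONLY: namespace `Literature.NumberTheory.LFunctions.BuiHall` (+ a `Part…` sub-namespace for the generated
decision-tree names), the shared definitions block replaced by `import Literature.NumberTheory.LFunctions.BuiHall.Defs`, module split to the hub's file-size cap,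
docstrings/provenance tags added; statements and proof scripts are verbatim unless a docstring says otherwise.

HEADLINE: `theorem_BH_sign : ∀ k₁ k₂ k₃ k₄, Even (k₁+k₂+k₃+k₄) → HARDY k₁ k₂ k₃ k₄ ≠ 0 ∧ (HARDY k₁ k₂ k₃ k₄ < 0 ↔ ‖i^k₁+i^k₂+i^k₃+i^k₄‖ = 2)`
= Bui–Hall, Bull. LMS 55 (2023) §1 Conjecture 1 [BuiHall2023], PROVED; trust base = the kernel (standard axioms), no named fact.
`theorem_BH` adds the «equivalently» clause (the mixed moment `∫_0^T Z^{(k₁)}Z^{(k₂)}Z^{(k₃)}Z^{(k₄)}` is eventually negative iff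
`‖Σ i^{k_j}‖ = 2`) CONDITIONALLY on the cited asymptotic `BuiHallMainTerm` (Bui–Hall's Thm. 3 with the defining display; a named
fact, not proved here). The only `def … : Prop` of these modules left without a proof is the cited analytic input `BuiHallMainTerm` (every intermediate
Prop has its `_holds`: StructureThm/ChartIdentity/AllEvenPos/OddOddCore/ElevenCore/LemmaCConclusions/Mixture in `Sign1–3`, MasterIneq/
Reduction/Spade here; the parametrized `CondC`/`CondI` hold for every pair by `condC_holds`/`condI_holds` of `Sign1`).
-/

set_option maxRecDepth 4000
set_option maxHeartbeats 2000000 -- generated certificate identities (`grind`) and long `linarith` calls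
set_option linter.unusedVariables false -- generated cell signatures are uniform; a given certificate uses only some hypotheses
set_option linter.unusedSimpArgs false -- the generated `simp only [...]` unfolding lists are uniform across cells
set_option linter.unusedTactic false -- idem (generated scripts)
set_option linter.unreachableTactic false -- idem (generated scripts)
set_option linter.style.longLine false -- generated one-line polynomial identities
set_option linter.style.longFile 0
set_option Elab.async false

noncomputable section

namespace Literature.NumberTheory.LFunctions.BuiHall

open _root_.MeasureTheory intervalIntegral _root_.Set _root_.Filter

/-! ## The master inequality `Λ ≤ 0` on `D`, assembled from the three kernel-checked parts -/

/-- **Theorem master** (box paper Thm. 12): `Λ(u,v;x,y) ≤ 0` on `D = {0 ≤ v ≤ u ≤ 1, 0 ≤ x, y ≤ 1}` — recombination by `le_total` at the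
first two branch points of the evaluator's decision tree of the three parts `PartTT.masterTT` (cells 0–92), `PartTF.masterTF` (cells 93–207),
`PartF.masterF` (cells 208–248), each proved in its `Master…` module from the exact Handelman certificates of the `Certs…` modules.
[cite: BuiHall2023, §1 Conjecture 1 — a step of THIS TREE's proof of it (box write-up paper-v3-d979a68f Thm. 12); the cited paper states the conjecture and the proof is ours] -/
theorem master_ineq : MasterIneq := by
  rintro u v x y ⟨hv0, hvu, hu1, hx0, hx1, hy0, hy1⟩
  have hu0 : 0 ≤ u := by linarith
  rcases le_total (x) (y + (1 - u)) with h1 | h1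
  · rcases le_total (1:ℝ) (y + (1 - u)) with h2 | h2
    · exact PartTT.masterTT u v x y hu0 (by linarith) hv0 (by linarith) hx0 (by linarith) hy0 (by linarith) h1 h2
    · exact PartTF.masterTF u v x y hu0 (by linarith) hv0 (by linarith) hx0 (by linarith) hy0 (by linarith) h1 h2
  · exact PartF.masterF u v x y hu0 (by linarith) hv0 (by linarith) hx0 (by linarith) hy0 (by linarith) h1

/-- Discharge, by name, of the box paper's Theorem master as the Prop `MasterIneq` of `Sign1`. [cite: BuiHall2023, §1 Conjecture 1 — a step of THIS TREE's proof of it (box write-up paper-v3-d979a68f Thm. 12); the cited paper states the conjecture and the proof is ours] -/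
theorem MasterIneq_holds : MasterIneq := master_ineq

/-- Discharge, by name, of Proposition reduce (`Reduction` of `Sign1`): Section 4.1's mixture argument (`reduction_of_mixture mixture_holds`).
[cite: BuiHall2023, §1 Conjecture 1 — a step of THIS TREE's proof of it (box write-up paper-v3-d979a68f Prop. 11); the cited paper states the conjecture and the proof is ours] -/
theorem Reduction_holds : Reduction := reduction_of_mixture mixture_holds

/-- The pointwise inequality (spade) for EVERY pair `(c, d)` — Prop. 11 fed with Theorem master (a closed statement; the predicate
`Spade c d` of `Sign1` is parametrized, so this is its by-name discharge for all parameters). [cite: BuiHall2023, §1 Conjecture 1 — a step of THIS TREE's proof of it (box write-up paper-v3-d979a68f Prop. 11 with Thm. 12); the cited paper states the conjecture and the proof is ours] -/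
theorem Spade_holds : ∀ c d : ℕ, Spade c d := fun c d => reduction_of_mixture mixture_holds master_ineq c d

/-! ## Hardy's function, the Bui–Hall main term (the ONE analytic assumption), and Theorem BH -/

section final
open scoped ComplexOrder


/-- `Z^{(k)}`, the `k`-th derivative of Hardy's function — through the TREE's real-valued Hardy function
`Literature.NumberTheory.LFunctions.hardyZ` (`RiemannSiegel.lean`: `Z(t) = Re(e^{iθ(t)} ζ(1/2 + it))`, Titchmarsh (4.17.2)); the box file's
own complex-valued copy of `Z` is not ported (tree vocabulary). [cite: BuiHall2023, §1 (the derivatives `Z^{(k)}(t)` of Hardy's function)] -/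
noncomputable def hardyZderiv (k : ℕ) : ℝ → ℝ := iteratedDeriv k hardyZ

/-- the mixed fourth moment `∫_0^T Z^{(k)} Z^{(ℓ)} Z^{(m)} Z^{(n)} dt` (a real number, cast to `ℂ` so that the asymptotic below is
typed exactly as printed, with the complex coefficient `HARDY`). [cite: BuiHall2023, §1 (the display defining HARDY before Thm. 3)] -/
noncomputable def mixedMoment (k l m n : ℕ) (T : ℝ) : ℂ :=
  ((∫ t in (0:ℝ)..T, hardyZderiv k t * hardyZderiv l t * hardyZderiv m t * hardyZderiv n t : ℝ) : ℂ)

/-- NAMED FACT (the ONE analytic input, used only by the «equivalently» clause of `theorem_BH`; NOT used by `theorem_BH_sign`) —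
**Bui–Hall's asymptotic with its explicit coefficient**, AS PRINTED (arXiv:2304.05178 = BLMS 55 (2023), §1: «we define the function
HARDY(k,ℓ,m,n) via the formula ∫_0^T Z^{(k)}(t)Z^{(ℓ)}(t)Z^{(m)}(t)Z^{(n)}(t)dt = HARDY(k,ℓ,m,n) π^{-2} T(log T)^{k+ℓ+m+n+4} + O(T(log T)^{k+ℓ+m+n+3})»
and «Theorem 3. We have HARDY(k,ℓ,m,n) = (−1)^{m+n} i^{k+ℓ+m+n} 3∫_0^1∫_0^1∫_0^1∫_0^1 (u₁−u₂)² (½+(u₁−u₂)u₃−u₁)^k (½+(u₂−u₁)u₃−u₂)^ℓ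
(½+(u₁−u₂)u₄−u₁)^m (½+(u₂−u₁)u₄−u₂)^n du»): for all `k, ℓ, m, n ≥ 0`, with `HARDY` = the quadruple integral of `Sign1`,
`∫_0^T Z^{(k)}Z^{(ℓ)}Z^{(m)}Z^{(n)} dt = HARDY(k,ℓ,m,n)/π² · T (log T)^{k+ℓ+m+n+4} + O(T (log T)^{k+ℓ+m+n+3})`. The box paper calls this
its eq. (BH)/(BHint). Typed with the tree's `hardyZ`. [cite: BuiHall2023, §1 Thm. 3 together with the display defining HARDY before it (arXiv:2304.05178 numbering)] -/
def BuiHallMainTerm : Prop :=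
  ∀ k l m n : ℕ,
    (fun T : ℝ => mixedMoment k l m n T
        - HARDY k l m n / (Real.pi : ℂ) ^ 2 * T * (Real.log T : ℂ) ^ (k + l + m + n + 4))
      =O[atTop] (fun T : ℝ => T * Real.log T ^ (k + l + m + n + 3))

/-- `HARDY` is real with the sign `(-1)^{K/2 + r}` (Theorem structure + eq. (conjM)) [cite: BuiHall2023, §1 Conjecture 1 — a step of THIS TREE's proof of it (box write-up paper-v3-d979a68f proof of Thm. 13); the cited paper states the conjecture and the proof is ours] -/
theorem HARDY_eq_real (hS : StructureThm) (k₁ k₂ k₃ k₄ : ℕ) (hK : Even (k₁ + k₂ + k₃ + k₄)) :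
    HARDY k₁ k₂ k₃ k₄ =
      (((-1 : ℝ) ^ ((k₁ + k₂ + k₃ + k₄) / 2 + nOdd k₁ k₂ k₃ k₄ / 2) * cK (k₁ + k₂ + k₃ + k₄) *
          ((-1 : ℝ) ^ (nOdd k₁ k₂ k₃ k₄ / 2) * M k₁ k₂ k₃ k₄) : ℝ) : ℂ) := by
  rw [structure_real_form hS]
  obtain ⟨j, hj⟩ := hK
  have hI : Complex.I ^ (k₁ + k₂ + k₃ + k₄) = (((-1 : ℝ) ^ ((k₁ + k₂ + k₃ + k₄) / 2) : ℝ) : ℂ) := by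
    rw [hj, show j + j = 2 * j by ring, pow_mul, Complex.I_sq]
    push_cast
    rw [Nat.mul_div_cancel_left j (by norm_num)]
  rw [hI]
  push_cast
  rw [pow_add]
  set a := (-1 : ℂ) ^ ((k₁ + k₂ + k₃ + k₄) / 2)
  set b := (-1 : ℂ) ^ (nOdd k₁ k₂ k₃ k₄ / 2)
  have hb : b * b = 1 := by rw [← mul_pow]; norm_num
  -- a * b * c * (b * m) = a * c * m  since b * b = 1
  linear_combination (-((cK (k₁ + k₂ + k₃ + k₄) : ℂ) * (M k₁ k₂ k₃ k₄ : ℂ) * a)) * hb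

/-- sign of a real main term forces the eventual sign of the moment (used for the «equivalently» clause) [cite: BuiHall2023, §1 Conjecture 1 — a step of THIS TREE's proof of it (box write-up paper-v3-d979a68f proof of Thm. 13: big-O ⇒ eventual sign); the cited paper states the conjecture and the proof is ours] -/
theorem eventually_re_neg_iff {K : ℕ} {c : ℝ} (hc : c ≠ 0) (E : ℝ → ℂ)
    (hE : (fun T : ℝ => E T - (c : ℂ) * T * (Real.log T : ℂ) ^ (K + 4)) =O[atTop]
      (fun T : ℝ => T * Real.log T ^ (K + 3))) :
    (∀ᶠ T in atTop, (E T).re < 0) ↔ c < 0 := by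
  obtain ⟨C, hC⟩ := hE.bound
  -- eventually the error is at most half the main term in size
  have key : ∀ᶠ T in atTop, |(E T).re - c * T * Real.log T ^ (K + 4)| ≤ |c| / 2 * (T * Real.log T ^ (K + 4)) ∧
      0 < T * Real.log T ^ (K + 4) := by
    have hT : ∀ᶠ T : ℝ in atTop, 1 ≤ T := eventually_ge_atTop 1
    have hL : ∀ᶠ T : ℝ in atTop, max 1 (2 * |C| / |c|) ≤ Real.log T :=
      Real.tendsto_log_atTop.eventually (eventually_ge_atTop _)
    filter_upwards [hC, hT, hL] with T h1 h2 h3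
    have hlog1 : 1 ≤ Real.log T := le_trans (le_max_left _ _) h3
    have hlogC : 2 * |C| / |c| ≤ Real.log T := le_trans (le_max_right _ _) h3
    have hpos : 0 < T * Real.log T ^ (K + 4) := by positivity
    refine ⟨?_, hpos⟩
    have hre : |(E T).re - c * T * Real.log T ^ (K + 4)| ≤ ‖E T - (c : ℂ) * T * (Real.log T : ℂ) ^ (K + 4)‖ := by
      have := Complex.abs_re_le_norm (E T - (c : ℂ) * T * (Real.log T : ℂ) ^ (K + 4))
      have e : (E T - (c : ℂ) * T * (Real.log T : ℂ) ^ (K + 4)).re = (E T).re - c * T * Real.log T ^ (K + 4) := by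
        rw [show (c : ℂ) * T * (Real.log T : ℂ) ^ (K + 4) = ((c * T * Real.log T ^ (K + 4) : ℝ) : ℂ) by push_cast; ring]
        rw [Complex.sub_re, Complex.ofReal_re]
      rwa [e] at this
    have hn : ‖(T * Real.log T ^ (K + 3) : ℝ)‖ = T * Real.log T ^ (K + 3) := by
      rw [Real.norm_eq_abs, abs_of_nonneg (by positivity)]
    rw [hn] at h1
    have hcpos : 0 < |c| := abs_pos.mpr hc
    calc |(E T).re - c * T * Real.log T ^ (K + 4)| ≤ C * (T * Real.log T ^ (K + 3)) := hre.trans h1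
      _ ≤ |C| * (T * Real.log T ^ (K + 3)) := mul_le_mul_of_nonneg_right (le_abs_self C) (by positivity)
      _ = (|C| / Real.log T) * (T * Real.log T ^ (K + 4)) := by
          field_simp
          ring
      _ ≤ |c| / 2 * (T * Real.log T ^ (K + 4)) := by
          apply mul_le_mul_of_nonneg_right _ hpos.le
          rw [div_le_iff₀ (by linarith)]
          rw [div_le_iff₀ hcpos] at hlogC
          nlinarith
  constructor
  · intro hneg
    by_contra hcn
    have hcpos : 0 < c := lt_of_le_of_ne (not_lt.mp hcn) (Ne.symm hc)
    obtain ⟨T, ⟨hk, hp⟩, hn⟩ := (key.and hneg).exists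
    have habs := abs_le.mp hk
    rw [abs_of_pos hcpos] at habs
    nlinarith [habs.1]
  · intro hcneg
    filter_upwards [key] with T ⟨hk, hp⟩
    have habs := abs_le.mp hk
    rw [abs_of_neg hcneg] at habs
    nlinarith [habs.2]

/-- **Theorem BH** (box paper Thm. 13, tex l.229–231): the Bui–Hall sign law for all orders, both clauses, together with the
«equivalently» clause on the mixed moment of Hardy's function. Hypothesis: `hBH` = the Bui–Hall main term `BuiHallMainTerm` (the ONE
analytic input, a cited named fact — needed only for the «equivalently» clause). Everything else is PROVED in the hub tree: the residue
rule (module `Sign1`), Lemma C, Corollary signs (a), Proposition oddodd's analytic step, the chart identity eq. (Tcd), Proposition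
11family's implication, Section 4.1 (mixture, Lemma QI, eq. (prims)), Theorem structure (modules `Sign1…Sign3`), and the master
inequality `Λ ≤ 0` on `D` (`master_ineq` below, from the 249 Handelman certificates of the `Certs…`/`Master…` modules).
[cite: BuiHall2023, §1 Conjecture 1 (first conjunct: PROVED here) and §1 Thm. 3 with the display defining HARDY (the «equivalently» clause: from the cited asymptotic)] -/
theorem theorem_BH (hBH : BuiHallMainTerm)
    (k₁ k₂ k₃ k₄ : ℕ) (hK : Even (k₁ + k₂ + k₃ + k₄)) :
    (HARDY k₁ k₂ k₃ k₄ ≠ 0 ∧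
      (HARDY k₁ k₂ k₃ k₄ < 0 ↔ ‖Complex.I ^ k₁ + Complex.I ^ k₂ + Complex.I ^ k₃ + Complex.I ^ k₄‖ = 2)) ∧
    ((∀ᶠ T in atTop, (mixedMoment k₁ k₂ k₃ k₄ T).re < 0) ↔
      ‖Complex.I ^ k₁ + Complex.I ^ k₂ + Complex.I ^ k₃ + Complex.I ^ k₄‖ = 2) := by
  set K := k₁ + k₂ + k₃ + k₄ with hKdef
  set r := nOdd k₁ k₂ k₃ k₄ / 2 with hrdef
  have hsM : 0 < (-1 : ℝ) ^ r * M k₁ k₂ k₃ k₄ :=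
    conjM_sign structureThm_holds chartIdentity_holds allEvenPos_holds oddOddCore_holds elevenCore_holds
      (reduction_of_mixture mixture_holds) lemmaC_conclusions master_ineq
      k₁ k₂ k₃ k₄ hK
  set x : ℝ := (-1 : ℝ) ^ (K / 2 + r) * cK K * ((-1 : ℝ) ^ r * M k₁ k₂ k₃ k₄) with hxdef
  have hH : HARDY k₁ k₂ k₃ k₄ = (x : ℂ) := HARDY_eq_real structureThm_holds k₁ k₂ k₃ k₄ hK
  have hcK := cK_pos K
  have hxne : x ≠ 0 := by
    have : (-1 : ℝ) ^ (K / 2 + r) ≠ 0 := pow_ne_zero _ (by norm_num)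
    positivity
  -- sign of x
  have hxsign : x < 0 ↔ Odd (K / 2 + r) := by
    rcases Nat.even_or_odd (K / 2 + r) with he | ho
    · rw [hxdef, he.neg_one_pow]; constructor
      · intro h; nlinarith
      · intro h; exact absurd he (Nat.not_even_iff_odd.mpr h)
    · rw [hxdef, ho.neg_one_pow]; constructor
      · intro _; exact ho
      · intro _; nlinarith
  have rule := bh_rule_iff_odd k₁ k₂ k₃ k₄ hK
  refine ⟨⟨?_, ?_⟩, ?_⟩
  · rw [hH]; exact_mod_cast hxne
  · rw [hH, rule, ← hxsign]
    rw [show (0:ℂ) = ((0:ℝ) : ℂ) from rfl, Complex.real_lt_real]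
  · -- the `equivalently' clause, from the Bui–Hall main term
    rw [rule, ← hxsign]
    have hE := hBH k₁ k₂ k₃ k₄
    rw [hH] at hE
    have hpi : (Real.pi : ℂ) ^ 2 = ((Real.pi ^ 2 : ℝ) : ℂ) := by push_cast; ring
    have hc : x / Real.pi ^ 2 ≠ 0 := div_ne_zero hxne (by positivity)
    have hE' : (fun T : ℝ => mixedMoment k₁ k₂ k₃ k₄ T - ((x / Real.pi ^ 2 : ℝ) : ℂ) * T * (Real.log T : ℂ) ^ (K + 4))
        =O[atTop] (fun T : ℝ => T * Real.log T ^ (K + 3)) := by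
      refine hE.congr' (Eventually.of_forall fun T => ?_) EventuallyEq.rfl
      simp only [hpi]
      push_cast
      ring
    rw [eventually_re_neg_iff hc _ hE']
    constructor
    · intro h
      by_contra hx
      have : 0 ≤ x / Real.pi ^ 2 := div_nonneg (not_lt.mp hx) (by positivity)
      linarith
    · intro h
      exact div_neg_of_neg_of_pos h (by positivity)

/-- **The Bui–Hall sign conjecture, PROVED (hypothesis-free)** — Bui–Hall, Bull. LMS 55 (2023), §1 Conjecture 1, AS PRINTED:
«If k+ℓ+m+n is even, then we have HARDY(k,ℓ,m,n) ≠ 0. Moreover, a necessary and sufficient condition that HARDY(k,ℓ,m,n) < 0 is that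
|i^k+i^ℓ+i^m+i^n| = 2.» Here `HARDY` is the quadruple integral of their Theorem 3 verbatim (`Sign1`), `<` is `ℂ`'s partial order
(`ComplexOrder`; `HARDY` is real for even `k+ℓ+m+n`). NO analytic input and NO statement of the box paper is a hypothesis: Theorem
structure, Lemma C, the chart identity, Propositions 6/8/11, Section 4.1 and the master inequality (249 kernel-checked certificates)
are all theorems of the modules `Sign…`, `Certs…`, `Master…`, assembled here. Hub-kernel port of the 2001-box leg
`summits/rh-w-lgap/free/y2` (box-kernel since 2026-08-12). [cite: BuiHall2023, §1 Conjecture 1 — PROVED in this tree] -/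
theorem theorem_BH_sign
    (k₁ k₂ k₃ k₄ : ℕ) (hK : Even (k₁ + k₂ + k₃ + k₄)) :
    HARDY k₁ k₂ k₃ k₄ ≠ 0 ∧
      (HARDY k₁ k₂ k₃ k₄ < 0 ↔ ‖Complex.I ^ k₁ + Complex.I ^ k₂ + Complex.I ^ k₃ + Complex.I ^ k₄‖ = 2) := by
  set K := k₁ + k₂ + k₃ + k₄ with hKdef
  set r := nOdd k₁ k₂ k₃ k₄ / 2 with hrdef
  have hsM : 0 < (-1 : ℝ) ^ r * M k₁ k₂ k₃ k₄ :=
    conjM_sign structureThm_holds chartIdentity_holds allEvenPos_holds oddOddCore_holds elevenCore_holds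
      (reduction_of_mixture mixture_holds) lemmaC_conclusions master_ineq
      k₁ k₂ k₃ k₄ hK
  set x : ℝ := (-1 : ℝ) ^ (K / 2 + r) * cK K * ((-1 : ℝ) ^ r * M k₁ k₂ k₃ k₄) with hxdef
  have hH : HARDY k₁ k₂ k₃ k₄ = (x : ℂ) := HARDY_eq_real structureThm_holds k₁ k₂ k₃ k₄ hK
  have hcK := cK_pos K
  have hxne : x ≠ 0 := by
    have : (-1 : ℝ) ^ (K / 2 + r) ≠ 0 := pow_ne_zero _ (by norm_num)
    positivity
  have hxsign : x < 0 ↔ Odd (K / 2 + r) := by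
    rcases Nat.even_or_odd (K / 2 + r) with he | ho
    · rw [hxdef, he.neg_one_pow]; constructor
      · intro h; nlinarith
      · intro h; exact absurd he (Nat.not_even_iff_odd.mpr h)
    · rw [hxdef, ho.neg_one_pow]; constructor
      · intro _; exact ho
      · intro _; nlinarith
  refine ⟨?_, ?_⟩
  · rw [hH]; exact_mod_cast hxne
  · rw [hH, bh_rule_iff_odd k₁ k₂ k₃ k₄ hK, ← hxsign]
    rw [show (0:ℂ) = ((0:ℝ) : ℂ) from rfl, Complex.real_lt_real]

end final

end Literature.NumberTheory.LFunctions.BuiHall
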